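import Summits.AtomisticToContinuum.BoseEinsteinCondensation.Theorems.BECCutLineWeakDisorderWitnessTransferFormBoundTranslate
import Literature.MathematicalPhysics.QuantumManyBody.GroundStateFeynmanKacFormUpper
import Literature.MathematicalPhysics.QuantumManyBody.GroundStateFeynmanKacInteraction
import HarnessLib

/-!
# Route BECCutLineWeakDisorder — `WitnessTransfer`, form bound II:
# the potential term of a rough witness

Support file (does not close the item) for item stmt-AtomisticToContinuum-14978
(`Summit.AtomisticToContinuum.BoseEinsteinCondensation.Theses.BECCutLineWeakDisorder`, decl
`WitnessTransfer`), stub `stub_formBound` (E1a) of line `Sketch`. For a measurable bounded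
`Ψ ≥ 0` vanishing off `Λ_L^N` with `∫ Ψ² = 1` and a general measurable pair potential
`v : ℝ → [0, ∞]`:

* `integrable_sq_of_box`, `memLp_two_of_box`, `lintegral_ofReal_sq_eq_one_of_box`,
  `lintegral_enorm_le_of_box` — `L¹/L²` bookkeeping of such a `Ψ`;
* `sqIncr_half_add_defect_le` — **the energy inequality**
  `sqIncr_t Ψ/2 + D_t ≤ 1 − e^{−Et}` from the integrated eigen-inequality
  `e^{−Et} ≤ ⟨Ψ, e^{−tH}Ψ⟩`, where `D_t = ∫ Ψ(x) E_x[(1 − w_t) Ψ(B_t)] dx` is the weight defect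
  (`integral_mul_integral_shift_eq`, `pairing_shift_sub_fkReal_eq`); consequences
  `fkDefect_ne_top_of_box`, `sqIncr_le_of_eig`, `nonneg_of_eig`;
* `interactionTerm_le_defect_add_sq` — **truncation inside the defect**: for `v' ≤ v` bounded,
  `J'_t = ∫ |Ψ| E[(∫₀ᵗV') |Ψ(B_t)|] ≤ D_t + Q'_t` with `Q'_t = ∫ |Ψ| E[(∫₀ᵗV')² |Ψ(B_t)|] = O(t²)`
  (`lintegral_pathAction_sq_le`);
* `lintegral_interaction_mul_le_interactionTerm_add` — **the slice lower bound integrated in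
  time without continuity**: `t ∫ V'Ψ² ≤ J'_t + N²C M · 3(η S + η⁻¹ 2|Λ|) · t` whenever
  `sqIncr_s Ψ ≤ S` on `s ≤ t` (`interactionSlice_le` + `translate_errors_le_three_mul`).

## References

* K. L. Chung, Z. Zhao, *From Brownian Motion to Schrödinger's Equation* (1995), Prop 3.29.
  [ChungZhao1995]
-/

noncomputable section

open MeasureTheory Filter Set Metric
open scoped ENNReal NNReal Topology

namespace Summit.AtomisticToContinuum.BoseEinsteinCondensation.Theorems.CutLineWitness

open Literature.MathematicalPhysics.QuantumManyBody.BoseGas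

variable {N : ℕ}

/-! ### `L¹ / L²` bookkeeping of a bounded function vanishing off the box -/

section Box

variable {L : ℝ} {Ψ : Config N → ℝ} {M : ℝ}

/-- A bounded measurable function vanishing off the box is square integrable. [folklore] -/
theorem integrable_sq_of_box (hΨm : Measurable Ψ) (hM : ∀ X, |Ψ X| ≤ M)
    (h0 : ∀ X, X ∉ boxN N L → Ψ X = 0) : Integrable (fun X => Ψ X ^ 2) volume := by
  have hg : Integrable ((boxN N L).indicator fun _ => M ^ 2) volume :=
    (integrableOn_const (volume_boxN_lt_top N L).ne).integrable_indicator (measurableSet_boxN N L)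
  refine hg.mono' (hΨm.pow_const 2).aestronglyMeasurable (Eventually.of_forall fun X => ?_)
  rw [Real.norm_eq_abs, abs_of_nonneg (sq_nonneg _)]
  by_cases hX : X ∈ boxN N L
  · rw [indicator_of_mem hX, ← sq_abs]
    exact pow_le_pow_left₀ (abs_nonneg _) (hM X) 2
  · rw [indicator_of_notMem hX, h0 X hX]
    simp

/-- A bounded measurable function vanishing off the box is in `L²`. [folklore] -/
theorem memLp_two_of_box (hΨm : Measurable Ψ) (hM : ∀ X, |Ψ X| ≤ M)
    (h0 : ∀ X, X ∉ boxN N L → Ψ X = 0) : MemLp Ψ 2 volume :=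
  (memLp_two_iff_integrable_sq hΨm.aestronglyMeasurable).2 (integrable_sq_of_box hΨm hM h0)

/-- `∫ Ψ² = 1` read in `[0, ∞]`. [folklore] -/
theorem lintegral_ofReal_sq_eq_one_of_box (hΨm : Measurable Ψ) (hM : ∀ X, |Ψ X| ≤ M)
    (h0 : ∀ X, X ∉ boxN N L → Ψ X = 0) (hnorm : ∫ X, Ψ X ^ 2 = 1) :
    ∫⁻ X, ENNReal.ofReal (Ψ X ^ 2) = 1 := by
  rw [← ofReal_integral_eq_lintegral_ofReal (integrable_sq_of_box hΨm hM h0)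
    (Eventually.of_forall fun X => sq_nonneg _), hnorm, ENNReal.ofReal_one]

/-- `∫ V |Ψ|ₑ² = ∫ ofReal (Ψ²) V`. [folklore] -/
theorem lintegral_interaction_mul_enorm_sq (v : ℝ → ℝ≥0∞) (Ψ : Config N → ℝ) :
    ∫⁻ x, interaction v x * ‖Ψ x‖ₑ ^ 2 = ∫⁻ X, ENNReal.ofReal (Ψ X ^ 2) * interaction v X := by
  refine lintegral_congr fun X => ?_
  rw [mul_comm, Real.enorm_eq_ofReal_abs, ← ENNReal.ofReal_pow (abs_nonneg _), sq_abs]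

/-- `‖Ψ‖₁ ≤ M |Λ_L^N|`. [folklore] -/
theorem lintegral_enorm_le_of_box (hM : ∀ X, |Ψ X| ≤ M) (h0 : ∀ X, X ∉ boxN N L → Ψ X = 0) :
    ∫⁻ x, ‖Ψ x‖ₑ ≤ ENNReal.ofReal M * volume (boxN N L) := by
  calc ∫⁻ x, ‖Ψ x‖ₑ ≤ ∫⁻ x, (boxN N L).indicator (fun _ => ENNReal.ofReal M) x := by
        refine lintegral_mono fun x => ?_
        by_cases hx : x ∈ boxN N L
        · rw [indicator_of_mem hx, Real.enorm_eq_ofReal_abs]; exact ENNReal.ofReal_le_ofReal (hM x)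
        · rw [indicator_of_notMem hx, h0 x hx]; simp
    _ = _ := by rw [lintegral_indicator (measurableSet_boxN N L), setLIntegral_const]

/-- A bounded truncated potential has finite energy in `Ψ`: `∫ V'|Ψ|² ≤ N²C ∫ ofReal Ψ²`.
[folklore] -/
theorem lintegral_interaction_mul_le_of_le {v' : ℝ → ℝ≥0∞} {C : ℝ≥0} (hC : ∀ r, v' r ≤ C)
    (Ψ : Config N → ℝ) :
    ∫⁻ x, interaction v' x * ‖Ψ x‖ₑ ^ 2 ≤ (N * N : ℕ) * C * ∫⁻ X, ENNReal.ofReal (Ψ X ^ 2) := by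
  rw [lintegral_interaction_mul_enorm_sq, ← lintegral_const_mul' _ _
    (ENNReal.mul_ne_top (ENNReal.natCast_ne_top _) ENNReal.coe_ne_top)]
  refine lintegral_mono fun X => ?_
  rw [mul_comm ((N * N : ℕ) * C : ℝ≥0∞)]
  exact mul_le_mul' le_rfl (interaction_le_of_le hC X)

end Box

/-! ### The energy inequality from the integrated eigen-inequality -/

section Eig

variable {L : ℝ} {v : ℝ → ℝ≥0∞} {Ψ : Config N → ℝ} {M E : ℝ}

/-- The weight defect `D_t = ∫ |Ψ(x)| E_x[(1 − w_t) |Ψ(B_t)|] dx ≤ M ‖Ψ‖₁`. [folklore] -/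
theorem fkDefect_le_of_box (v : ℝ → ℝ≥0∞) (L : ℝ) (t : ℝ≥0) (hM : ∀ X, |Ψ X| ≤ M) :
    (∫⁻ x, ‖Ψ x‖ₑ * ∫⁻ ω, (1 - fkWeight v L t x ω) * ‖Ψ (x + displacement t ω)‖ₑ ∂wienerPaths N) ≤
      ENNReal.ofReal M * ∫⁻ x, ‖Ψ x‖ₑ := by
  calc (∫⁻ x, ‖Ψ x‖ₑ * ∫⁻ ω, (1 - fkWeight v L t x ω) * ‖Ψ (x + displacement t ω)‖ₑ ∂wienerPaths N)
      ≤ ∫⁻ x, ‖Ψ x‖ₑ * ∫⁻ _ω, ENNReal.ofReal M ∂wienerPaths N := by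
        refine lintegral_mono fun x => mul_le_mul' le_rfl (lintegral_mono fun ω => ?_)
        calc (1 - fkWeight v L t x ω) * ‖Ψ (x + displacement t ω)‖ₑ ≤ 1 * ENNReal.ofReal M := by
              refine mul_le_mul' tsub_le_self ?_
              rw [Real.enorm_eq_ofReal_abs]; exact ENNReal.ofReal_le_ofReal (hM _)
          _ = ENNReal.ofReal M := one_mul _
    _ = ENNReal.ofReal M * ∫⁻ x, ‖Ψ x‖ₑ := by
        simp only [lintegral_const, measure_univ, mul_one]
        rw [← lintegral_const_mul' _ _ ENNReal.ofReal_ne_top]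
        exact lintegral_congr fun x => mul_comm _ _

/-- The weight defect of a bounded function vanishing off the box is finite. [folklore] -/
theorem fkDefect_ne_top_of_box (v : ℝ → ℝ≥0∞) (L : ℝ) (t : ℝ≥0) (hM : ∀ X, |Ψ X| ≤ M)
    (h0 : ∀ X, X ∉ boxN N L → Ψ X = 0) :
    (∫⁻ x, ‖Ψ x‖ₑ * ∫⁻ ω, (1 - fkWeight v L t x ω) * ‖Ψ (x + displacement t ω)‖ₑ ∂wienerPaths N) ≠
      ⊤ :=
  ne_top_of_le_ne_top (ENNReal.mul_ne_top ENNReal.ofReal_ne_top (ne_top_of_le_ne_top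
    (ENNReal.mul_ne_top ENNReal.ofReal_ne_top (volume_boxN_lt_top N L).ne)
      (lintegral_enorm_le_of_box hM h0))) (fkDefect_le_of_box v L t hM)

/-- **The energy inequality of a witness.** If a measurable bounded `Ψ ≥ 0` vanishing off the box
with `∫Ψ² = 1` satisfies `e^{−Et} ≤ ⟨Ψ, e^{−tH}Ψ⟩`, then
`sqIncr_t Ψ / 2 + D_t ≤ 1 − e^{−Et}` (`⟨Ψ, P_tΨ⟩ = 1 − sqIncr_t/2` and
`⟨Ψ, P_tΨ⟩ − ⟨Ψ, T_tΨ⟩ = D_t`). [cite: ChungZhao1995, Prop 3.29] -/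
theorem sqIncr_half_add_defect_le (hv : Measurable v) (hΨm : Measurable Ψ) (hM : ∀ X, |Ψ X| ≤ M)
    (hnn : ∀ X, 0 ≤ Ψ X) (h0 : ∀ X, X ∉ boxN N L → Ψ X = 0) (hnorm : ∫ X, Ψ X ^ 2 = 1)
    (heig : ∀ t : ℝ, 0 < t → Real.exp (-(E * t)) ≤ ∫ X, Ψ X * fkReal v L t Ψ X) {t : ℝ≥0}
    (ht : 0 < t) :
    (sqIncr t Ψ).toReal / 2 + (∫⁻ x, ‖Ψ x‖ₑ * ∫⁻ ω, (1 - fkWeight v L t x ω) *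
        ‖Ψ (x + displacement t ω)‖ₑ ∂wienerPaths N).toReal ≤ 1 - Real.exp (-(E * t)) := by
  have hP := integral_mul_integral_shift_eq hΨm (memLp_two_of_box hΨm hM h0) t
  have hD := pairing_shift_sub_fkReal_eq hv L t hΨm hM hnn h0
  have hbox : ∫ x in boxN N L, Ψ x * fkReal v L t Ψ x = ∫ x, Ψ x * fkReal v L t Ψ x :=
    setIntegral_eq_integral_of_forall_compl_eq_zero fun x hx => by rw [h0 x hx, zero_mul]
  have he := heig t ht
  rw [hP, hnorm, hbox] at hD
  linarith

/-- The slope is nonnegative: `0 ≤ E`. [folklore] -/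
theorem nonneg_of_eig (hv : Measurable v) (hΨm : Measurable Ψ) (hM : ∀ X, |Ψ X| ≤ M)
    (hnn : ∀ X, 0 ≤ Ψ X) (h0 : ∀ X, X ∉ boxN N L → Ψ X = 0) (hnorm : ∫ X, Ψ X ^ 2 = 1)
    (heig : ∀ t : ℝ, 0 < t → Real.exp (-(E * t)) ≤ ∫ X, Ψ X * fkReal v L t Ψ X) : 0 ≤ E := by
  have h := sqIncr_half_add_defect_le hv hΨm hM hnn h0 hnorm heig (t := 1) one_pos
  have h1 : 0 ≤ (sqIncr 1 Ψ).toReal / 2 := by positivity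
  have h2 : (0 : ℝ) ≤ (∫⁻ x, ‖Ψ x‖ₑ * ∫⁻ ω, (1 - fkWeight v L ((1 : ℝ≥0) : ℝ) x ω) *
      ‖Ψ (x + displacement 1 ω)‖ₑ ∂wienerPaths N).toReal := ENNReal.toReal_nonneg
  have h3 : Real.exp (-(E * ((1 : ℝ≥0) : ℝ))) ≤ 1 := by linarith
  rw [NNReal.coe_one, mul_one, Real.exp_le_one_iff] at h3
  linarith

/-- **The Gaussian increment of a witness is small**: `sqIncr_s Ψ ≤ 2(1 − e^{−Et})` for
`0 < s ≤ t`. [folklore] -/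
theorem sqIncr_le_of_eig (hv : Measurable v) (hΨm : Measurable Ψ) (hM : ∀ X, |Ψ X| ≤ M)
    (hnn : ∀ X, 0 ≤ Ψ X) (h0 : ∀ X, X ∉ boxN N L → Ψ X = 0) (hnorm : ∫ X, Ψ X ^ 2 = 1)
    (heig : ∀ t : ℝ, 0 < t → Real.exp (-(E * t)) ≤ ∫ X, Ψ X * fkReal v L t Ψ X) {s t : ℝ≥0}
    (hs : 0 < s) (hst : s ≤ t) :
    sqIncr s Ψ ≤ ENNReal.ofReal (2 * (1 - Real.exp (-(E * t)))) := by
  have hE := nonneg_of_eig hv hΨm hM hnn h0 hnorm heig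
  have h := sqIncr_half_add_defect_le hv hΨm hM hnn h0 hnorm heig hs
  have h2 : (0 : ℝ) ≤ (∫⁻ x, ‖Ψ x‖ₑ * ∫⁻ ω, (1 - fkWeight v L (s : ℝ) x ω) *
      ‖Ψ (x + displacement s ω)‖ₑ ∂wienerPaths N).toReal := ENNReal.toReal_nonneg
  have hmono : Real.exp (-(E * t)) ≤ Real.exp (-(E * s)) := by
    refine Real.exp_le_exp.2 (neg_le_neg (mul_le_mul_of_nonneg_left ?_ hE))
    exact_mod_cast hst
  have hfin : sqIncr s Ψ ≠ ⊤ := (sqIncr_lt_top hΨm (by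
    rw [lintegral_ofReal_sq_eq_one_of_box hΨm hM h0 hnorm]; exact ENNReal.one_ne_top) s).ne
  rw [← ENNReal.ofReal_toReal hfin]
  exact ENNReal.ofReal_le_ofReal (by linarith)

end Eig

/-! ### Truncation inside the defect: `J' ≤ D + Q'` -/

section Trunc

variable {L : ℝ} {v v' : ℝ → ℝ≥0∞} {C : ℝ≥0} {f : Config N → ℝ} {M : ℝ}

/-- **The truncated interaction term is dominated by the defect up to second order**: for a
bounded `v' ≤ v`,
`∫ |f| E[(∫₀ᵗV') |f(B_t)|] ≤ ∫ |f| E[(1 − w_t) |f(B_t)|] + ∫ |f| E[(∫₀ᵗV')² |f(B_t)|]`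
(`w_t ≤ e^{−∫₀ᵗV} ≤ e^{−∫₀ᵗV'}`, `a ≤ 1 − e^{−a} + a²`; no killing term). [folklore] -/
theorem interactionTerm_le_defect_add_sq (hv : Measurable v) (hC : ∀ r, v' r ≤ C)
    (hle : ∀ r, v' r ≤ v r) (L : ℝ) (t : ℝ≥0) (hf : Measurable f) :
    (∫⁻ x, ‖f x‖ₑ * ∫⁻ ω, pathAction v' t x ω * ‖f (worldLine x ω t)‖ₑ ∂wienerPaths N) ≤
      (∫⁻ x, ‖f x‖ₑ * ∫⁻ ω, (1 - fkWeight v L t x ω) * ‖f (x + displacement t ω)‖ₑ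
        ∂wienerPaths N) +
      ∫⁻ x, ‖f x‖ₑ * ∫⁻ ω, pathAction v' t x ω ^ 2 * ‖f (x + displacement t ω)‖ₑ
        ∂wienerPaths N := by
  have hshift : Measurable fun p : Config N × PathSpace N => f (p.1 + displacement t p.2) :=
    hf.comp (measurable_fst.add ((measurable_displacement t).comp measurable_snd))
  have hFm : ∀ x, Measurable fun ω : PathSpace N => ‖f (x + displacement t ω)‖ₑ := fun x =>
    (hf.comp ((measurable_displacement t).const_add x)).enorm
  have hD1 : Measurable fun p : Config N × PathSpace N =>
      (1 - fkWeight v L t p.1 p.2) * ‖f (p.1 + displacement t p.2)‖ₑ :=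
    (measurable_const.sub (measurable_fkWeight_uncurry hv L t)).mul hshift.enorm
  have hDx : ∀ x, Measurable fun ω : PathSpace N =>
      (1 - fkWeight v L t x ω) * ‖f (x + displacement t ω)‖ₑ := fun x =>
    (measurable_const.sub (measurable_fkWeight hv L t x)).mul (hFm x)
  have htop : ∀ (x : Config N) (ω : PathSpace N), pathAction v' t x ω ≠ ⊤ := fun x ω =>
    ne_top_of_le_ne_top (ENNReal.mul_ne_top (ENNReal.mul_ne_top (ENNReal.natCast_ne_top _)
      ENNReal.coe_ne_top) ENNReal.ofReal_ne_top) (pathAction_le_of_le hC t x ω)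
  have hx : ∀ x, ‖f x‖ₑ * ∫⁻ ω, pathAction v' t x ω * ‖f (worldLine x ω t)‖ₑ ∂wienerPaths N ≤
      ‖f x‖ₑ * (∫⁻ ω, (1 - fkWeight v L t x ω) * ‖f (x + displacement t ω)‖ₑ ∂wienerPaths N) +
      ‖f x‖ₑ * ∫⁻ ω, pathAction v' t x ω ^ 2 * ‖f (x + displacement t ω)‖ₑ ∂wienerPaths N := by
    intro x
    rw [← mul_add, ← lintegral_add_left (hDx x)]
    refine mul_le_mul' le_rfl (lintegral_mono fun ω => ?_)
    rw [← add_mul, worldLine_eq_add_displacement]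
    exact mul_le_mul' (pathAction_le_one_sub_fkWeight_add_sq_of_le hle L t x ω (htop x ω)) le_rfl
  calc (∫⁻ x, ‖f x‖ₑ * ∫⁻ ω, pathAction v' t x ω * ‖f (worldLine x ω t)‖ₑ ∂wienerPaths N)
      ≤ ∫⁻ x, (‖f x‖ₑ * (∫⁻ ω, (1 - fkWeight v L t x ω) * ‖f (x + displacement t ω)‖ₑ
            ∂wienerPaths N) +
          ‖f x‖ₑ * ∫⁻ ω, pathAction v' t x ω ^ 2 * ‖f (x + displacement t ω)‖ₑ ∂wienerPaths N) :=
        lintegral_mono hx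
    _ = _ := lintegral_add_left (hf.enorm.mul hD1.lintegral_prod_right') _

/-- **The second-order term is `O(t²)`**: `∫ |f| E[(∫₀ᵗV')² |f(B_t)|] ≤ (N²C t)² M ‖f‖₁` for
`v' ≤ C`, `|f| ≤ M`. [folklore] -/
theorem lintegral_pathAction_sq_le (hC : ∀ r, v' r ≤ C) (t : ℝ≥0) (hM : ∀ x, |f x| ≤ M) :
    (∫⁻ x, ‖f x‖ₑ * ∫⁻ ω, pathAction v' t x ω ^ 2 * ‖f (x + displacement t ω)‖ₑ ∂wienerPaths N) ≤
      ((N * N : ℕ) * C * ENNReal.ofReal t) ^ 2 * ENNReal.ofReal M * ∫⁻ x, ‖f x‖ₑ := by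
  have hcV_top : ((N * N : ℕ) * C : ℝ≥0∞) ≠ ⊤ :=
    ENNReal.mul_ne_top (ENNReal.natCast_ne_top _) ENNReal.coe_ne_top
  calc (∫⁻ x, ‖f x‖ₑ * ∫⁻ ω, pathAction v' t x ω ^ 2 * ‖f (x + displacement t ω)‖ₑ ∂wienerPaths N)
      ≤ ∫⁻ x, ‖f x‖ₑ * ∫⁻ _ω, ((N * N : ℕ) * C * ENNReal.ofReal t) ^ 2 * ENNReal.ofReal M
          ∂wienerPaths N := by
        refine lintegral_mono fun x => mul_le_mul' le_rfl (lintegral_mono fun ω => ?_)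
        refine mul_le_mul' (pow_le_pow_left' (pathAction_le_of_le hC t x ω) 2) ?_
        rw [Real.enorm_eq_ofReal_abs]; exact ENNReal.ofReal_le_ofReal (hM _)
    _ = ((N * N : ℕ) * C * ENNReal.ofReal t) ^ 2 * ENNReal.ofReal M * ∫⁻ x, ‖f x‖ₑ := by
        simp only [lintegral_const, measure_univ, mul_one]
        rw [← lintegral_const_mul' _ _ (ENNReal.mul_ne_top (ENNReal.pow_ne_top
          (ENNReal.mul_ne_top hcV_top ENNReal.ofReal_ne_top)) ENNReal.ofReal_ne_top)]
        exact lintegral_congr fun x => by ring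

/-! ### The slice lower bound integrated in time, without continuity -/

/-- **`t ∫ V'|f|² ≤ J'_t + (N²C M) · 3(η S + η⁻¹ · 2|Λ|) · t`** for a bounded `v' ≤ C`, a bounded
measurable `f` vanishing off the box with `sqIncr_s f ≤ S` for `s ≤ t`, and `η > 0`
(Tonelli in time, the deterministic slice comparison `interactionSlice_le`, and the translation
errors by `translate_errors_le_three_mul`). [cite: ChungZhao1995, §3.3 (3.35)] -/
theorem lintegral_interaction_mul_le_interactionTerm_add {N : ℕ} {L : ℝ} {v' : ℝ → ℝ≥0∞} {C : ℝ≥0}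
    {f : Config N → ℝ} {M : ℝ} (hv' : Measurable v') (hC : ∀ r, v' r ≤ C) (hf : Measurable f)
    (hM : ∀ x, |f x| ≤ M) (h0 : ∀ X, X ∉ boxN N L → f X = 0) {t : ℝ≥0} {S : ℝ≥0∞}
    (hS : ∀ s : ℝ≥0, s ≤ t → sqIncr s f ≤ S) {η : ℝ} (hη : 0 < η) :
    (∫⁻ x, interaction v' x * ‖f x‖ₑ ^ 2) * t ≤
      (∫⁻ x, ‖f x‖ₑ * ∫⁻ ω, pathAction v' t x ω * ‖f (worldLine x ω t)‖ₑ ∂wienerPaths N) +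
      ((N * N : ℕ) * C * ENNReal.ofReal M) *
        (3 * (ENNReal.ofReal η * S + (ENNReal.ofReal η)⁻¹ * (2 * volume (boxN N L)))) * t := by
  have hM' : ∀ x, ‖f x‖ ≤ M := fun x => by rw [Real.norm_eq_abs]; exact hM x
  set I : ℝ≥0∞ := ∫⁻ x, interaction v' x * ‖f x‖ₑ ^ 2 with hI
  set err : ℝ≥0∞ := ((N * N : ℕ) * C * ENNReal.ofReal M) *
    (3 * (ENNReal.ofReal η * S + (ENNReal.ofReal η)⁻¹ * (2 * volume (boxN N L)))) with herr
  have hslice : ∀ s : ℝ≥0, s ≤ t → I ≤ (∫⁻ ω, ∫⁻ x, ‖f x‖ₑ * interaction v' (worldLine x ω s) *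
      ‖f (worldLine x ω t)‖ₑ ∂volume ∂wienerPaths N) + err := fun s hs =>
    (interactionSlice_le (N := N) hv' hC hf hM' s t).2.trans (add_le_add le_rfl
      (mul_le_mul' le_rfl (translate_errors_le_three_mul hf h0 (hS s hs) (hS t le_rfl) hη)))
  rw [interactionTerm_eq_lintegral_Ioc hv' hf t]
  have hvol : volume (Ioc (0 : ℝ) t) = (t : ℝ≥0∞) := by
    rw [Real.volume_Ioc, sub_zero, ENNReal.ofReal_coe_nnreal]
  calc I * t = ∫⁻ _s in Ioc (0 : ℝ) t, I := by rw [setLIntegral_const, hvol]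
    _ ≤ ∫⁻ s in Ioc (0 : ℝ) t, ((∫⁻ ω, ∫⁻ x,
        ‖f x‖ₑ * interaction v' (worldLine x ω s.toNNReal) * ‖f (worldLine x ω t)‖ₑ
          ∂volume ∂wienerPaths N) + err) := by
        refine setLIntegral_mono' measurableSet_Ioc fun s hs' => ?_
        exact hslice s.toNNReal (Real.toNNReal_le_iff_le_coe.2 hs'.2)
    _ = _ := by rw [lintegral_add_right _ measurable_const, setLIntegral_const, hvol]

end Trunc

end Summit.AtomisticToContinuum.BoseEinsteinCondensation.Theorems.CutLineWitness

end
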